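import Summits.QuantumFields.BalabanUV.T4Continuum.Support.NE9LastCouplingBridge

/-!
# NE9VacuumSubtractedBridge — the NE9 END with the VACUUM-SUBTRACTED representation of the new term
(`𝐄^{(k+1)}(X, U) = Re Σ_clusters(U) − Re Σ_clusters(U₀) + coupling-free part`): the explicit part's coupling modulus is
NO LONGER A BINDER (cell `pub-balaban`, T4-DAG §2 node U3 / §6 NE9; lineage t4-ne9-p1 = prover P1, generation 21;
skeleton `t4/b2b-balaban-t4-ne9-p1/SKELETON-NE9-P1.md` leaf A4 / swarm item (w4))

HONEST FRAMING (T4-DAG PAGE 1).  Rung (B)+1 on a FIXED finite torus with `FlowStep.BetaPertH` and (B) explicit — NOT infinite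
volume, NOT a mass gap, NOT the Clay problem.  NE9 (`T4OutputRate.NE9 ∧ FadingMemory`) is a cell NEW ESTIMATE, NOT PRINTED,
and is NOT discharged here: every theorem below is bookkeeping over the ABSTRACT carriers of `T4OutputRate` and the abstract
cluster geometry `ClusterGeom`; every analytic input is a DISPLAYED binder.  [I] = [Balaban1987RG1], [II] = [Balaban1988RG2Cluster]
are quoted for TYPES/STRUCTURE only (ABSOLUTE RULE).  BetaPertH, (B), (B^μ) do not occur.

WHY.  The END `NE9LastCouplingBridge.ne9_and_fadingMemory_of_couplingTwoPoint` represents the new term as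
`Ψ k s P U X = Re(newTerm act k s U X (ρ k P)) + expl k s U X` and asks for the explicit part a last-coupling modulus `pex k`
(`hexpl`) — a displayed binder (skeleton leaf A4).  In print the «explicit part» is NOT an independent function of the
coupling: [I] (2.13)–(2.14) p. 268, «E^{(k+1)}(g_k, U_{k+1}) = log ∫ dμ_{C^{(k)}}(B) χ_k exp[…]  (2.13)  … log 𝐍″_k =
𝐄^{(k+1)}(g_k, 1)  (2.14)»: the normalisation subtracts THE SAME FUNCTIONAL AT THE TRIVIAL BACKGROUND `U₀ = 1`, and the
remaining additive piece «[log Z^{(k)}(U_{k+1}) − log Z^{(k)}(1)]» of (2.12) is the quotient of two Gaussian normalisations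
(«with the covariance C^{(k)} = C^{(k)}(U_{k+1}) = (C*Δ^{(k)}C)^{−1}», p. 268), which does not contain the coupling.  With the
VACUUM-SUBTRACTED representation

  `hreprV : Ψ k s P U X = Re(newTerm act k s U X (ρ k P)) − Re(newTerm act k s U₀ X (ρ k P)) + explZ k U X`

(`explZ` coupling-free AND table-free) the coupling modulus of the subtracted term is supplied by the SAME coupling two-point
data `hCup` at the background `U₀` (it quantifies over all backgrounds), and leaf A4 disappears: the END below has NO `hexpl`,
`pex`, `pexbar`.  Price: the constants double (`8·` for `4·`).

WHAT IS PROVED (kernel, `[folklore]` bookkeeping).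
§1 `outputLipschitz_of_twoPointKP_vacSub`: `OutputLipschitz E W T Ψ κ wt (fun k => 8·lip k·B₀ k)` (P2's
   `outputLipschitz_of_twoPointKP` at `U` and at `U₀`).
§2 `lastCouplingLipschitz_of_couplingTwoPoint_vacSub`: `LastCouplingLipschitz E W T Ψ κ (fun k => 8·clip k·B₀ k + 8·lip k·B₀ k·qT k)`.
§3 **`ne9_and_fadingMemory_of_couplingTwoPoint_vacSub`**: `NE9 E W κ Λ ∧ FadingMemory (ℓ/ω′) ω′ Λ` with
   `Λ = prodModuli ℓ (fun _ => ω′)`, `ℓ = 8·clipbar·B + 8·lipbar·B·qTbar`, `ω′ = ω + 8·lipbar·B·τ̄` — binders: the structure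
   binders of P2 (`ScaleZeroFree`, `AdmissibleTerms`, `AdmRestrict`, `ChannelAdditive`, `ChannelStepSum`, `ChannelSizeAtStepNN`,
   `Factorises`), `hreprV`, `TwoPointKP`, `hCup`, `hTcup`, `DecayExtract`, `PinBudget`, the reading law `hρ`, the occupation
   `hocc`, scalars.  Nothing about [I]/[II] asserted; 0/9 unchanged.

References (TYPES only): [Balaban1987RG1] CMP 109 (1987) (2.12)–(2.14) p. 268; [Balaban1988RG2Cluster] CMP 116 (1988)
(2.13)–(2.15) pp. 14–15, Lemma 3 (2.38) p. 20, (2.40)–(2.41) p. 21; [KoteckyPreiss1986] CMP 103 (1986) (the engine, tree-proved).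
-/

noncomputable section

namespace Summit.QuantumFields.BalabanUV.T4Continuum.NE9VacuumSubtractedBridge

open scoped BigOperators
open Literature.Probability.LatticeModels
open Literature.MathematicalPhysics.QuantumFieldTheory.Balaban1983to89
open Literature.MathematicalPhysics.QuantumFieldTheory.Balaban1983to89.T4OutputRate
open Literature.MathematicalPhysics.QuantumFieldTheory.Balaban1983to89.T4ActivityLipschitz
open Literature.MathematicalPhysics.QuantumFieldTheory.Balaban1983to89.T4HistoryLipschitzRecursion
open Literature.MathematicalPhysics.QuantumFieldTheory.Balaban1983to89.T4HistoryLipschitzOuter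
open Literature.MathematicalPhysics.QuantumFieldTheory.Balaban1983to89.T4HistoryLipschitzActivity
open Literature.MathematicalPhysics.QuantumFieldTheory.Balaban1983to89.T4HistoryLipschitzActivity (ClusterGeom)
open Literature.MathematicalPhysics.QuantumFieldTheory.Balaban1983to89.T4HistoryLipschitzSegment
open Summit.QuantumFields.BalabanUV.T4Continuum.NE9LastCouplingBridge

variable {C : Carriers} (G : ClusterGeom C) {Bg : Type} {Pot : Type*} [NormedAddCommGroup Pot]

/-! ## §1 OutputLipschitz under the vacuum-subtracted representation -/

/-- `|Re z − Re z′| ≤ ‖z‖ + ‖z′‖`-type bookkeeping: `|(z₁ − z₂).re − (z₃ − z₄).re| ≤ ‖z₁ − z₂‖ + ‖z₃ − z₄‖`. [folklore] -/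
theorem abs_re_sub_re_le (z z' : ℂ) : |z.re - z'.re| ≤ ‖z‖ + ‖z'‖ := by
  calc |z.re - z'.re| ≤ |z.re| + |z'.re| := abs_sub _ _
    _ ≤ ‖z‖ + ‖z'‖ := add_le_add (Complex.abs_re_le_norm _) (Complex.abs_re_le_norm _)

/-- **`OutputLipschitz` with the vacuum subtraction**: TWO-POINT KP ∧ DECAY ∧ PIN BUDGET, the reading law, the occupation of the
occurring tables and `hreprV` ⇒ `OutputLipschitz E W T Ψ κ wt (fun k => 8·lip k·B₀ k)` — P2's `outputLipschitz_of_twoPointKP`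
applied at the background `U` and at the reference background `U₀`. [cite: Balaban1987RG1, (2.13)-(2.14) p.268; Balaban1988RG2Cluster, (2.40)-(2.41) p.21] -/
theorem outputLipschitz_of_twoPointKP_vacSub {ι : Type} {E : Functional C Bg} {W : Set (ℕ → ℝ)}
    {T : ℕ → (ℕ → ℝ) → (Bg → C.Dom → ℝ) → ι → ℝ} {Ψ : ℕ → ℝ → (ι → ℝ) → Bg → C.Dom → ℝ}
    {act : ℕ → ℝ → Bg → Pot → G.P → ℂ} {𝒜 : ℕ → Set Pot} {n : ℕ → ℝ → Bg → G.P → ℝ} {lip : ℕ → ℝ}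
    {a d : G.P → ℝ} {δ : C.Dom → ℝ} {B₀ : ℕ → ℝ} {κ : ℝ} {wt : ℕ → ι → ℝ} (ρ : ℕ → (ι → ℝ) → Pot) (U₀ : Bg)
    (explZ : ℕ → Bg → C.Dom → ℝ) (hK : TwoPointKP G W act 𝒜 n lip a d) (hdec : G.DecayExtract δ d)
    (hpin : G.PinBudget a δ B₀ κ)
    (hρ : ∀ (k : ℕ) (P P' : ι → ℝ) (M : ℝ), (∀ y, |P y - P' y| ≤ wt k y * M) → ‖ρ k P - ρ k P'‖ ≤ M)
    (hreprV : ∀ (k : ℕ) (s : ℝ) (P : ι → ℝ) (U : Bg) (X : C.Dom),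
      Ψ k s P U X = (G.newTerm act k s U X (ρ k P)).re - (G.newTerm act k s U₀ X (ρ k P)).re + explZ k U X)
    (hocc : ∀ g ∈ W, ∀ g' ∈ W, ∀ k : ℕ, ρ k (T k g' (E g)) ∈ 𝒜 k) :
    OutputLipschitz E W T Ψ κ wt (fun k => 8 * lip k * B₀ k) := by
  intro g hg g' hg' k M hM U X hX
  set Q := ρ k (T k g' (E g))
  set Q' := ρ k (T k g' (E g'))
  have hQQ' : ‖Q - Q'‖ ≤ M := hρ k _ _ M hM
  have hQ : Q ∈ 𝒜 k := hocc g hg g' hg' k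
  have hQ' : Q' ∈ 𝒜 k := hocc g' hg' g' hg' k
  have ha0 : 0 ≤ a (G.pin X) := hK.1 _
  have hlip0 : 0 ≤ lip k := hK.2.2.1 k
  have henv := hpin k X hX
  have bound : ∀ V : Bg, ‖G.newTerm act k (g' k) V X Q - G.newTerm act k (g' k) V X Q'‖ ≤
      Real.exp (-(κ * C.d X)) * (4 * lip k * B₀ k * M) := by
    intro V
    have key := norm_newTerm_sub_le_of_twoPointKP G hK hdec hg' hX (U := V) hQ hQ'
    calc ‖G.newTerm act k (g' k) V X Q - G.newTerm act k (g' k) V X Q'‖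
        ≤ 4 * (lip k * ‖Q - Q'‖) * a (G.pin X) * Real.exp (-(δ X)) := key
      _ = 4 * lip k * ‖Q - Q'‖ * (a (G.pin X) * Real.exp (-(δ X))) := by ring
      _ ≤ 4 * lip k * M * (B₀ k * Real.exp (-(κ * C.d X))) :=
          mul_le_mul (mul_le_mul_of_nonneg_left hQQ' (by positivity)) henv (mul_nonneg ha0 (Real.exp_nonneg _))
            (by have := (norm_nonneg _).trans hQQ'; positivity)
      _ = Real.exp (-(κ * C.d X)) * (4 * lip k * B₀ k * M) := by ring
  rw [hreprV, hreprV]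
  calc |(G.newTerm act k (g' k) U X Q).re - (G.newTerm act k (g' k) U₀ X Q).re + explZ k U X -
          ((G.newTerm act k (g' k) U X Q').re - (G.newTerm act k (g' k) U₀ X Q').re + explZ k U X)|
      = |(G.newTerm act k (g' k) U X Q - G.newTerm act k (g' k) U X Q').re -
          (G.newTerm act k (g' k) U₀ X Q - G.newTerm act k (g' k) U₀ X Q').re| := by
        rw [Complex.sub_re, Complex.sub_re]; ring_nf
    _ ≤ ‖G.newTerm act k (g' k) U X Q - G.newTerm act k (g' k) U X Q'‖ +
          ‖G.newTerm act k (g' k) U₀ X Q - G.newTerm act k (g' k) U₀ X Q'‖ := abs_re_sub_re_le _ _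
    _ ≤ Real.exp (-(κ * C.d X)) * (4 * lip k * B₀ k * M) + Real.exp (-(κ * C.d X)) * (4 * lip k * B₀ k * M) :=
        add_le_add (bound U) (bound U₀)
    _ = Real.exp (-(κ * C.d X)) * (8 * lip k * B₀ k * M) := by ring

/-! ## §2 The binder (L) under the vacuum-subtracted representation -/

/-- **`LastCouplingLipschitz` with the vacuum subtraction**: COUPLING TWO-POINT (`hCup`, at `U` and at `U₀`) ∧ CHANNEL COUPLING
MODULUS (`hTcup`) ∧ TWO-POINT KP ∧ decay ∧ pin budget ∧ reading law ∧ occupation ∧ `hreprV` ⇒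
`LastCouplingLipschitz E W T Ψ κ (fun k => 8·clip k·B₀ k + 8·lip k·B₀ k·qT k)` — the coupling-free part `explZ` CANCELS in the
difference; no modulus is asked of it. [cite: Balaban1987RG1, p.263 (1.18) and (2.12)-(2.14) p.268; Balaban1988RG2Cluster, (2.40)-(2.41) p.21] -/
theorem lastCouplingLipschitz_of_couplingTwoPoint_vacSub {ι : Type} {E : Functional C Bg} {W : Set (ℕ → ℝ)}
    {T : ℕ → (ℕ → ℝ) → (Bg → C.Dom → ℝ) → ι → ℝ} {Ψ : ℕ → ℝ → (ι → ℝ) → Bg → C.Dom → ℝ}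
    {act : ℕ → ℝ → Bg → Pot → G.P → ℂ} {𝒜 : ℕ → Set Pot} {n : ℕ → ℝ → Bg → G.P → ℝ} {lip clip : ℕ → ℝ}
    {a d : G.P → ℝ} {δ : C.Dom → ℝ} {B₀ qT : ℕ → ℝ} {κ : ℝ} {wt : ℕ → ι → ℝ} (ρ : ℕ → (ι → ℝ) → Pot) (U₀ : Bg)
    (explZ : ℕ → Bg → C.Dom → ℝ) (hK : TwoPointKP G W act 𝒜 n lip a d) (hclip0 : ∀ k, 0 ≤ clip k)
    (hCup : ∀ g ∈ W, ∀ g' ∈ W, ∀ (k : ℕ) (U : Bg) (X : C.Dom), C.scale X = k + 1 → ∀ Q ∈ 𝒜 k, ∀ γ ∈ G.vol X,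
      ‖act k (g k) U Q γ‖ ≤ n k (g' k) U γ ∧
        ‖act k (g k) U Q γ - act k (g' k) U Q γ‖ ≤ clip k * |g k - g' k| * n k (g' k) U γ)
    (hdec : G.DecayExtract δ d) (hpin : G.PinBudget a δ B₀ κ)
    (hρ : ∀ (k : ℕ) (P P' : ι → ℝ) (M : ℝ), (∀ y, |P y - P' y| ≤ wt k y * M) → ‖ρ k P - ρ k P'‖ ≤ M)
    (hreprV : ∀ (k : ℕ) (s : ℝ) (P : ι → ℝ) (U : Bg) (X : C.Dom),
      Ψ k s P U X = (G.newTerm act k s U X (ρ k P)).re - (G.newTerm act k s U₀ X (ρ k P)).re + explZ k U X)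
    (hqT0 : ∀ k, 0 ≤ qT k)
    (hTcup : ∀ g ∈ W, ∀ g' ∈ W, ∀ (k : ℕ) (y : ι), |T k g (E g) y - T k g' (E g) y| ≤ wt k y * (qT k * |g k - g' k|))
    (hocc : ∀ g ∈ W, ∀ g' ∈ W, ∀ k : ℕ, ρ k (T k g' (E g)) ∈ 𝒜 k) :
    LastCouplingLipschitz E W T Ψ κ (fun k => 8 * clip k * B₀ k + 8 * lip k * B₀ k * qT k) := by
  intro g hg g' hg' k U X hX
  set P : ι → ℝ := T k g (E g)
  set P' : ι → ℝ := T k g' (E g)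
  have hQ : ρ k P ∈ 𝒜 k := hocc g hg g hg k
  have hQ' : ρ k P' ∈ 𝒜 k := hocc g hg g' hg' k
  have ha0 : 0 ≤ a (G.pin X) := hK.1 _
  have hlip0 : 0 ≤ lip k := hK.2.2.1 k
  have hclip0k : 0 ≤ clip k := hclip0 k
  have hqT0k : 0 ≤ qT k := hqT0 k
  have henv := hpin k X hX
  have hΔ : 0 ≤ |g k - g' k| := abs_nonneg _
  -- (i) same configuration, two couplings, at any background V
  have h1 : ∀ V : Bg, ‖G.newTerm act k (g k) V X (ρ k P) - G.newTerm act k (g' k) V X (ρ k P)‖ ≤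
      Real.exp (-(κ * C.d X)) * (4 * clip k * B₀ k * |g k - g' k|) := by
    intro V
    have hnt := norm_newTerm_sub_le_of_couplingTwoPoint G hK hclip0 hCup hdec hg hg' hX (U := V) hQ
    calc ‖G.newTerm act k (g k) V X (ρ k P) - G.newTerm act k (g' k) V X (ρ k P)‖
        ≤ 4 * (clip k * |g k - g' k|) * a (G.pin X) * Real.exp (-(δ X)) := hnt
      _ = 4 * clip k * |g k - g' k| * (a (G.pin X) * Real.exp (-(δ X))) := by ring
      _ ≤ 4 * clip k * |g k - g' k| * (B₀ k * Real.exp (-(κ * C.d X))) :=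
          mul_le_mul_of_nonneg_left henv (by positivity)
      _ = Real.exp (-(κ * C.d X)) * (4 * clip k * B₀ k * |g k - g' k|) := by ring
  -- (ii) same coupling g′ k, two occurring configurations, at any background V
  have hdist : ‖ρ k P - ρ k P'‖ ≤ qT k * |g k - g' k| :=
    hρ k P P' (qT k * |g k - g' k|) fun y => hTcup g hg g' hg' k y
  have h2 : ∀ V : Bg, ‖G.newTerm act k (g' k) V X (ρ k P) - G.newTerm act k (g' k) V X (ρ k P')‖ ≤
      Real.exp (-(κ * C.d X)) * (4 * lip k * B₀ k * qT k * |g k - g' k|) := by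
    intro V
    have hnt := norm_newTerm_sub_le_of_twoPointKP G hK hdec hg' hX (U := V) hQ hQ'
    calc ‖G.newTerm act k (g' k) V X (ρ k P) - G.newTerm act k (g' k) V X (ρ k P')‖
        ≤ 4 * (lip k * ‖ρ k P - ρ k P'‖) * a (G.pin X) * Real.exp (-(δ X)) := hnt
      _ = 4 * lip k * ‖ρ k P - ρ k P'‖ * (a (G.pin X) * Real.exp (-(δ X))) := by ring
      _ ≤ 4 * lip k * (qT k * |g k - g' k|) * (B₀ k * Real.exp (-(κ * C.d X))) :=
          mul_le_mul (mul_le_mul_of_nonneg_left hdist (by positivity)) henv (mul_nonneg ha0 (Real.exp_nonneg _))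
            (by positivity)
      _ = Real.exp (-(κ * C.d X)) * (4 * lip k * B₀ k * qT k * |g k - g' k|) := by ring
  -- combine: at U and at U₀, couplings then configurations
  have h3 : ∀ V : Bg, ‖G.newTerm act k (g k) V X (ρ k P) - G.newTerm act k (g' k) V X (ρ k P')‖ ≤
      Real.exp (-(κ * C.d X)) * ((4 * clip k * B₀ k + 4 * lip k * B₀ k * qT k) * |g k - g' k|) := by
    intro V
    calc ‖G.newTerm act k (g k) V X (ρ k P) - G.newTerm act k (g' k) V X (ρ k P')‖
        ≤ ‖G.newTerm act k (g k) V X (ρ k P) - G.newTerm act k (g' k) V X (ρ k P)‖ +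
            ‖G.newTerm act k (g' k) V X (ρ k P) - G.newTerm act k (g' k) V X (ρ k P')‖ := norm_sub_le_norm_sub_add_norm_sub _ _ _
      _ ≤ Real.exp (-(κ * C.d X)) * (4 * clip k * B₀ k * |g k - g' k|) +
            Real.exp (-(κ * C.d X)) * (4 * lip k * B₀ k * qT k * |g k - g' k|) := add_le_add (h1 V) (h2 V)
      _ = Real.exp (-(κ * C.d X)) * ((4 * clip k * B₀ k + 4 * lip k * B₀ k * qT k) * |g k - g' k|) := by ring
  rw [hreprV k (g k) P U X, hreprV k (g' k) P' U X]
  calc |(G.newTerm act k (g k) U X (ρ k P)).re - (G.newTerm act k (g k) U₀ X (ρ k P)).re + explZ k U X -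
          ((G.newTerm act k (g' k) U X (ρ k P')).re - (G.newTerm act k (g' k) U₀ X (ρ k P')).re + explZ k U X)|
      = |(G.newTerm act k (g k) U X (ρ k P) - G.newTerm act k (g' k) U X (ρ k P')).re -
          (G.newTerm act k (g k) U₀ X (ρ k P) - G.newTerm act k (g' k) U₀ X (ρ k P')).re| := by
        rw [Complex.sub_re, Complex.sub_re]; ring_nf
    _ ≤ ‖G.newTerm act k (g k) U X (ρ k P) - G.newTerm act k (g' k) U X (ρ k P')‖ +
          ‖G.newTerm act k (g k) U₀ X (ρ k P) - G.newTerm act k (g' k) U₀ X (ρ k P')‖ := abs_re_sub_re_le _ _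
    _ ≤ Real.exp (-(κ * C.d X)) * ((4 * clip k * B₀ k + 4 * lip k * B₀ k * qT k) * |g k - g' k|) +
          Real.exp (-(κ * C.d X)) * ((4 * clip k * B₀ k + 4 * lip k * B₀ k * qT k) * |g k - g' k|) :=
        add_le_add (h3 U) (h3 U₀)
    _ = Real.exp (-(κ * C.d X)) * ((8 * clip k * B₀ k + 8 * lip k * B₀ k * qT k) * |g k - g' k|) := by ring

/-! ## §3 END-TO-END: NE9 ∧ FADING MEMORY with the vacuum-subtracted representation (no `hexpl`) -/

/-- **NE9 ∧ FADING MEMORY FROM TWO-POINT KP IN BOTH VARIABLES, VACUUM-SUBTRACTED REPRESENTATION, every conditional by name**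
— `NE9LastCouplingBridge.ne9_and_fadingMemory_of_couplingTwoPoint` with `hrepr` ∧ `hexpl` REPLACED by `hreprV`
(«log 𝐍″_k = 𝐄^{(k+1)}(g_k, 1)», [I] (2.14): the subtracted term is the same cluster sum at the reference background `U₀`,
its coupling modulus comes from the same `hCup`; the remaining additive piece `explZ` is coupling-free and cancels).  Moduli
`Λ k i = ℓ·ω′^{k−1−i}`, `ℓ = 8·clipbar·B + 8·lipbar·B·qTbar`, `ω′ = ω + 8·lipbar·B·τ̄`; fading iff `ω′ < 1`.  DISPLAYED after
this leaf: P2's printed-STRUCTURE binders, `hreprV`, `ChannelSizeAtStepNN` + contraction profile, `TwoPointKP` + `hCup` (ONE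
configuration-free majorant, TYPE (2.15)→(2.38) = PROOF-INTERIOR of (B)), `DecayExtract`, `PinBudget`, `hTcup`, the reading
law, the occupation `hocc` (DERIVED in P2 §9), scalars.  Nothing about [I]/[II] asserted; 0/9 unchanged.
[cite: Balaban1987RG1, p.263 (1.18), (2.12)-(2.14) p.268; Balaban1988RG2Cluster, (1.36) p.9, (2.13)-(2.15) pp.14-15,
Lemma 3 (2.38) p.20, (2.41) p.21; KoteckyPreiss1986, (1)-(4) p.492] -/
theorem ne9_and_fadingMemory_of_couplingTwoPoint_vacSub [NormedSpace ℂ Pot] {ι : Type} {E : Functional C Bg}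
    {W : Set (ℕ → ℝ)} {Adm : Set (Bg → C.Dom → ℝ)} {T : ℕ → (ℕ → ℝ) → (Bg → C.Dom → ℝ) → ι → ℝ}
    {Ψ : ℕ → ℝ → (ι → ℝ) → Bg → C.Dom → ℝ} {act : ℕ → ℝ → Bg → Pot → G.P → ℂ} {𝒜 : ℕ → Set Pot}
    {n : ℕ → ℝ → Bg → G.P → ℝ} {lip clip : ℕ → ℝ} {a d : G.P → ℝ} {δ : C.Dom → ℝ}
    {κ B lipbar clipbar qTbar τbar ω : ℝ} {wt : ℕ → ι → ℝ} {τ : ℕ → ℕ → ℝ} {qT : ℕ → ℝ}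
    (ρ : ℕ → (ι → ℝ) → Pot) (U₀ : Bg) (explZ : ℕ → Bg → C.Dom → ℝ) (h0 : ScaleZeroFree E W)
    (hAdm : AdmissibleTerms E W Adm) (hres : AdmRestrict Adm) (hadd : ChannelAdditive Adm T)
    (hsum : ChannelStepSum Adm T) (hstep : ChannelSizeAtStepNN Adm T κ wt τ) (hfac : Factorises E W T Ψ)
    (hclip0 : ∀ k, 0 ≤ clip k)
    (hCup : ∀ g ∈ W, ∀ g' ∈ W, ∀ (k : ℕ) (U : Bg) (X : C.Dom), C.scale X = k + 1 → ∀ Q ∈ 𝒜 k, ∀ γ ∈ G.vol X,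
      ‖act k (g k) U Q γ‖ ≤ n k (g' k) U γ ∧
        ‖act k (g k) U Q γ - act k (g' k) U Q γ‖ ≤ clip k * |g k - g' k| * n k (g' k) U γ)
    (hqT0 : ∀ k, 0 ≤ qT k)
    (hTcup : ∀ g ∈ W, ∀ g' ∈ W, ∀ (k : ℕ) (y : ι), |T k g (E g) y - T k g' (E g) y| ≤ wt k y * (qT k * |g k - g' k|))
    (hreprV : ∀ (k : ℕ) (s : ℝ) (P : ι → ℝ) (U : Bg) (X : C.Dom),
      Ψ k s P U X = (G.newTerm act k s U X (ρ k P)).re - (G.newTerm act k s U₀ X (ρ k P)).re + explZ k U X)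
    (hclipb : ∀ k, clip k ≤ clipbar) (hqTb : ∀ k, qT k ≤ qTbar)
    (hK : TwoPointKP G W act 𝒜 n lip a d) (hdec : G.DecayExtract δ d) (hpin : G.PinBudget a δ (fun _ => B) κ)
    (hρ : ∀ (k : ℕ) (P P' : ι → ℝ) (M : ℝ), (∀ y, |P y - P' y| ≤ wt k y * M) → ‖ρ k P - ρ k P'‖ ≤ M)
    (hocc : ∀ g ∈ W, ∀ g' ∈ W, ∀ k : ℕ, ρ k (T k g' (E g)) ∈ 𝒜 k) (hB : 0 ≤ B)
    (hlipb : ∀ k, lip k ≤ lipbar) (hτbar : 0 ≤ τbar) (hω : 0 ≤ ω) (hpos : 0 < ω + 8 * lipbar * B * τbar)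
    (hτ : ∀ k j, j ≤ k → 0 ≤ τ k j ∧ τ k j ≤ τbar * ω ^ (k - j)) :
    NE9 E W κ (prodModuli (8 * clipbar * B + 8 * lipbar * B * qTbar) fun _ => ω + 8 * lipbar * B * τbar) ∧
      FadingMemory ((8 * clipbar * B + 8 * lipbar * B * qTbar) / (ω + 8 * lipbar * B * τbar))
        (ω + 8 * lipbar * B * τbar)
        (prodModuli (8 * clipbar * B + 8 * lipbar * B * qTbar) fun _ => ω + 8 * lipbar * B * τbar) := by
  have hlast := lastCouplingLipschitz_of_couplingTwoPoint_vacSub G ρ U₀ explZ hK hclip0 hCup hdec hpin hρ hreprV hqT0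
    hTcup hocc
  have hout := outputLipschitz_of_twoPointKP_vacSub G ρ U₀ explZ hK hdec hpin hρ hreprV hocc
  have houter := outerLipschitz_of_factorisation hfac hlast hout
  have hlip0 : ∀ k, 0 ≤ lip k := hK.2.2.1
  have hclipbar : 0 ≤ clipbar := (hclip0 0).trans (hclipb 0)
  have hlipbar : 0 ≤ lipbar := (hlip0 0).trans (hlipb 0)
  have hqTbar : 0 ≤ qTbar := (hqT0 0).trans (hqTb 0)
  have hℓ : 0 ≤ 8 * clipbar * B + 8 * lipbar * B * qTbar := by positivity
  have hc : 0 ≤ 8 * lipbar * B := by positivity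
  have hlam : ∀ k, 8 * clip k * B + 8 * lip k * B * qT k ≤ 8 * clipbar * B + 8 * lipbar * B * qTbar := by
    intro k
    have h1 : 8 * clip k * B ≤ 8 * clipbar * B := by gcongr; exact hclipb k
    have h3 : 8 * lip k * B * qT k ≤ 8 * lipbar * B * qTbar := by
      have := hlipb k; have := hqTb k; have := hlip0 k; have := hqT0 k
      gcongr
    linarith
  have hcΦ : ∀ k, 0 ≤ 8 * lip k * B ∧ 8 * lip k * B ≤ 8 * lipbar * B := fun k =>
    ⟨by have := hlip0 k; positivity, by gcongr; exact hlipb k⟩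
  exact ne9_and_fadingMemory_of_perStepNN h0 hAdm hres hadd hsum hstep houter hℓ hc hτbar hω hpos hlam hcΦ hτ

end Summit.QuantumFields.BalabanUV.T4Continuum.NE9VacuumSubtractedBridge

end
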